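import Summits.QuantumAdvantage.QuantumAdvantage.Theorems.LinnikCubicClassGroupsDegreeOnePrimesEscapeHeckeConjugateIndex
import Literature.NumberTheory.LFunctions.ClassGroupLFunctionExceptionalZero
import HarnessLib

/-!
# The smoothed Chebotarev theorem for a cyclic extension in the Linnik range, WITH THE SIGN of the exceptional term

Topic `Summits/QuantumAdvantage/QuantumAdvantage/Theorems`, cell B2b-1 (linnik-cubic), PART A (gen 13); helper
toward the crux `DegreeOnePrimesEscape` (stmt-QuantumAdvantage-11543) — step B6 of the LMO programme for
conjugacy classes inside a division.  HONEST FRAMING: the value of this file is a THEOREM (kernel-checked,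
GRH-free) — NOT summit progress.

`smoothedFrobenius_dichotomy` (`…FrobeniusSmoothed.lean`, gen 12) gives, for a cyclic `N|E` and every
`τ ∈ Gal(N|E)`, the two-sided smoothed count `m T_τ(g_x) = F(−1) − χ₁(τ)^{−j₀} F(−β₁) + O(…)` with SOME index
`j₀ < m`.  Here the same theorem is re-assembled keeping track of WHICH factor of `ζ_N = ζ_E ∏_{0<j<m} L_j`
carries the exceptional zero (`smoothedFrobenius_dichotomy_signed`): with a second window constant `c' ≤ c`
(the Landau–Page constant of `exists_exceptionalZero_const`, so that a real zero `β₁` of `ζ₁_N` in the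
`c'`-window is SIMPLE), for `β₁` in the `c'`-window the index `j₀` satisfies
`j₀ = 0 ↔ ζ₁_E(β₁) = 0` and `(χ₁(τ)^{j₀})² = 1` for every `τ` — i.e. the coefficient `χ₁(τ)^{−j₀}` of the
exceptional term is `±1`, `= +1` for all `τ` iff `ζ_E(β₁) = 0`, and otherwise `= −1` exactly at the `τ`
outside the index-2 subgroup of `Gal(N|E)` (`…HeckeConjugateIndex.lean`: `heckeIndex_two_mul_eq`).  This is
the reality of the exceptional character `χ₁` in [LagariasMontgomeryOdlyzko1979, Thm. 1.1].  Clauses (A) and (B)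
(window constant `c`, unsigned) are kept, since a zero in the `c`-window outside the `c'`-window still has
to be accounted for downstream.
References: [LagariasMontgomeryOdlyzko1979, §§3, 7]; [ThornerZaman2019, Thm. 1.4, Thm. 3.1]; [Weiss1983, Thm. 5.2].
-/

noncomputable section

open Complex Real Finset NumberField IsDedekindDomain
open scoped NumberField nonZeroDivisors Classical

namespace Summit.QuantumAdvantage.QuantumAdvantage.Theorems.DegreeOnePrimesEscape

open Literature.NumberTheory.LFunctions Literature.NumberTheory.LFunctions.NumberField
  Literature.NumberTheory.LFunctions.EntireEF Literature.NumberTheory.LFunctions.TZWeight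
  Literature.NumberTheory.LFunctions.AbelianDensity Literature.NumberTheory.GaloisRepresentations

set_option maxHeartbeats 3200000 in
/-- **The smoothed Chebotarev theorem for a cyclic extension in the Linnik range, two-sided, with the
exceptional zero of `ζ_N` and the SIGN of its coefficient** (see the module docstring): clauses (A), (B) as in
`smoothedFrobenius_dichotomy` (window constant `c`), and (B') for `β₁` in the smaller `c'`-window:
`j₀ = 0 ↔ ζ₁_E(β₁) = 0` and `(χ₁(τ)^{j₀})² = 1`. [cite: LagariasMontgomeryOdlyzko1979, §7, Theorem 1.1]
[cite: ThornerZaman2019, Theorem 1.4] -/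
theorem smoothedFrobenius_dichotomy_signed (n₀ : ℕ) (hn₀ : 1 < n₀) {η : ℝ} (hη : 0 < η) :
    ∃ ν a₁ c c' : ℝ, 0 < ν ∧ ν ≤ 1 / 64 ∧ 1 ≤ a₁ ∧ 0 < c ∧ c ≤ 1 / (8 * ((n₀ : ℝ) ^ 2 + 1)) ∧
      0 < c' ∧ c' ≤ c ∧
    ∀ (E N : Type) [Field E] [NumberField E] [Field N] [NumberField N] [Algebra E N] [IsGalois E N]
      [IsCyclic (N ≃ₐ[E] N)], Module.finrank ℚ N = n₀ → 1 < Module.finrank ℚ E →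
    ∃ χ₁ : (N ≃ₐ[E] N) →* ℂˣ, Function.Injective χ₁ ∧
      (∀ (τ : N ≃ₐ[E] N) (wτ : Ideal (𝓞 E) → ℝ),
        (∀ I, wτ I = if (∃ v : HeightOneSpectrum (𝓞 E), Algebra.IsUnramifiedIn (𝓞 N) v.asIdeal ∧
          ∃ k : ℕ, I = v.asIdeal ^ k ∧ galFrob E N v ^ k = τ) then 1 else 0) →
        ∀ x : ℝ, ThornerZaman.condQn N ^ a₁ ≤ x →
          (¬ ∃ β₁ : ℝ, dedekindZeta₁ N β₁ = 0 ∧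
            1 - c / (Real.log ((NumberField.discr N).natAbs : ℝ) + Real.log 4) < β₁ ∧ β₁ < 1) →
          ‖(Module.finrank E N : ℂ) *
                ((∑' k : ℕ, (∑ I ∈ idealsOfNorm E k, wτ I * idealVonMangoldt I) *
                  tzTest (Real.log x) (x ^ (-ν)) (Real.log k) : ℝ) : ℂ) -
              fordLaplace (tzTest (Real.log x) (x ^ (-ν))) (-1)‖ ≤
            η * x + n₀ * ((NumberField.discr N).natAbs.primeFactors.card) * (Real.log x + 1)) ∧
      (∀ β₁ : ℝ, dedekindZeta₁ N β₁ = 0 →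
          1 - c / (Real.log ((NumberField.discr N).natAbs : ℝ) + Real.log 4) < β₁ → β₁ < 1 →
        ∃ j₀ : ℕ, j₀ < Module.finrank E N ∧
        ∀ (τ : N ≃ₐ[E] N) (wτ : Ideal (𝓞 E) → ℝ),
          (∀ I, wτ I = if (∃ v : HeightOneSpectrum (𝓞 E), Algebra.IsUnramifiedIn (𝓞 N) v.asIdeal ∧
            ∃ k : ℕ, I = v.asIdeal ^ k ∧ galFrob E N v ^ k = τ) then 1 else 0) →
          ∀ x : ℝ, ThornerZaman.condQn N ^ a₁ ≤ x →
            ‖(Module.finrank E N : ℂ) *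
                  ((∑' k : ℕ, (∑ I ∈ idealsOfNorm E k, wτ I * idealVonMangoldt I) *
                    tzTest (Real.log x) (x ^ (-ν)) (Real.log k) : ℝ) : ℂ) -
                fordLaplace (tzTest (Real.log x) (x ^ (-ν))) (-1) +
                (((χ₁ τ : ℂˣ) : ℂ)⁻¹) ^ j₀ * fordLaplace (tzTest (Real.log x) (x ^ (-ν))) (-(β₁ : ℂ))‖ ≤
              η * x * min 1 ((1 - β₁) * Real.log x) +
                n₀ * ((NumberField.discr N).natAbs.primeFactors.card) * (Real.log x + 1)) ∧
      (∀ β₁ : ℝ, dedekindZeta₁ N β₁ = 0 →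
          1 - c' / (Real.log ((NumberField.discr N).natAbs : ℝ) + Real.log 4) < β₁ → β₁ < 1 →
        ∃ j₀ : ℕ, j₀ < Module.finrank E N ∧ (j₀ = 0 ↔ dedekindZeta₁ E β₁ = 0) ∧
        (∀ τ : N ≃ₐ[E] N, ((((χ₁ τ : ℂˣ) : ℂ)) ^ j₀) ^ 2 = 1) ∧
        ∀ (τ : N ≃ₐ[E] N) (wτ : Ideal (𝓞 E) → ℝ),
          (∀ I, wτ I = if (∃ v : HeightOneSpectrum (𝓞 E), Algebra.IsUnramifiedIn (𝓞 N) v.asIdeal ∧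
            ∃ k : ℕ, I = v.asIdeal ^ k ∧ galFrob E N v ^ k = τ) then 1 else 0) →
          ∀ x : ℝ, ThornerZaman.condQn N ^ a₁ ≤ x →
            ‖(Module.finrank E N : ℂ) *
                  ((∑' k : ℕ, (∑ I ∈ idealsOfNorm E k, wτ I * idealVonMangoldt I) *
                    tzTest (Real.log x) (x ^ (-ν)) (Real.log k) : ℝ) : ℂ) -
                fordLaplace (tzTest (Real.log x) (x ^ (-ν))) (-1) +
                (((χ₁ τ : ℂˣ) : ℂ)⁻¹) ^ j₀ * fordLaplace (tzTest (Real.log x) (x ^ (-ν))) (-(β₁ : ℂ))‖ ≤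
              η * x * min 1 ((1 - β₁) * Real.log x) +
                n₀ * ((NumberField.discr N).natAbs.primeFactors.card) * (Real.log x + 1)) := by
  classical
  obtain ⟨c₀, hc₀, hpack⟩ := exists_exceptionalZero_const n₀
  obtain ⟨A, -, hA⟩ := Residue.residueLowerBound_all n₀
  obtain ⟨b, D, hb, hD, hdens⟩ := fam_density_local n₀ hn₀ A
  have ha : (1 : ℝ) ≤ max A 4 := le_trans (by norm_num) (le_max_right _ _)
  obtain ⟨ν, a₁, c, hν0, hν64, ha₁1, hc, hcn, hmain⟩ :=
    deuringSum_dichotomy_dh n₀ hn₀ hb hD ha hη deuringHeilbronn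
  set c' : ℝ := min c c₀ with hc'def
  have hc'0 : 0 < c' := lt_min hc hc₀
  have hc'c : c' ≤ c := min_le_left _ _
  have hc'c₀ : c' ≤ c₀ := min_le_right _ _
  refine ⟨ν, a₁, c, c', hν0, hν64, ha₁1, hc, hcn, hc'0, hc'c, ?_⟩
  intro E N _ _ _ _ _ _ _ hNn hE
  haveI : FiniteDimensional E N := Module.Finite.of_restrictScalars_finite ℚ E N
  obtain ⟨χ₁, 𝔣, χ, p, L, hχ₁, hdata, hsupp, hval, h𝔣0, hχ0, hnt, -, hdisc, hL, -, hord⟩ :=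
    CyclicExtension.exists_primitive_heckeFactorisation E N
  set m : ℕ := Module.finrank E N with hm
  have hm1 : 1 ≤ m := Module.finrank_pos
  have hdeg : Module.finrank ℚ N = Module.finrank ℚ E * m := (Module.finrank_mul_finrank ℚ E N).symm
  have hcard : Nat.card (N ≃ₐ[E] N) = m := IsGalois.card_aut_eq_finrank E N
  have hN : 1 < Module.finrank ℚ N := by rw [hNn]; exact hn₀
  -- sizes
  set Q : ℝ := ThornerZaman.condQn N with hQ
  have hQ12 : (12 : ℝ) ≤ Q := ThornerZaman.twelve_le_condQn (K := N) hN
  have hQ1 : (1 : ℝ) < Q := by linarith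
  -- `j ∈ Ico 1 m ⇒ ¬ m ∣ j`
  have hndvd : ∀ j ∈ Finset.Ico 1 m, ¬ m ∣ j := by
    intro j hj hdvd
    rw [Finset.mem_Ico] at hj
    exact absurd (Nat.le_of_dvd (by omega) hdvd) (by omega)
  -- the dual continuations
  have hex' : ∀ j, ∃ L' : ℂ → ℂ, j ∈ Finset.Ico 1 m →
      Differentiable ℂ L' ∧ ∀ s : ℂ, 1 < s.re → L' s = rayClassLSeries (𝔣 j) (star (χ j)) s := by
    intro j
    by_cases hj : j ∈ Finset.Ico 1 m
    · obtain ⟨v, hv, hv1⟩ := hnt j (hndvd j hj)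
      have hnt' : ∃ v : HeightOneSpectrum (𝓞 E), ¬ 𝔣 j ≤ v.asIdeal ∧ (star (χ j)) v ≠ 1 := by
        refine ⟨v, hv, fun h ↦ hv1 ?_⟩
        rw [Pi.star_apply, Complex.star_def] at h
        have := congrArg (starRingEnd ℂ) h
        rwa [Complex.conj_conj, map_one] at this
      obtain ⟨L', hL'd, hL's⟩ := exists_differentiable_eq_rayClassLSeries (hdata j).1 (hdata j).2.1.star hnt'
      exact ⟨L', fun _ ↦ ⟨hL'd, hL's⟩⟩
    · exact ⟨fun _ ↦ 0, fun h ↦ absurd h hj⟩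
  choose L' hL' using hex'
  -- conductor–discriminant consequences
  have hdN0 : 0 < (NumberField.discr N).natAbs := Int.natAbs_pos.mpr (NumberField.discr_ne_zero N)
  have hfac : ∀ j ∈ Finset.range m, (NumberField.discr E).natAbs * Ideal.absNorm (𝔣 j) ≤ (NumberField.discr N).natAbs :=
    fun j hj ↦ Nat.le_of_dvd hdN0 (hdisc ▸ Finset.dvd_prod_of_mem _ hj)
  have hcond : ∀ j ∈ Finset.Ico 1 m, |(NumberField.discr E : ℝ)| * (Ideal.absNorm (𝔣 j) : ℝ) ≤ (NumberField.discr N).natAbs := by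
    intro j hj
    have h := hfac j (Finset.mem_range.mpr (Finset.mem_Ico.mp hj).2)
    rw [← Int.cast_abs, ← Nat.cast_natAbs]
    exact_mod_cast h
  have hdE : ((NumberField.discr E).natAbs : ℝ) ≤ (NumberField.discr N).natAbs := by
    have h := hfac 0 (Finset.mem_range.mpr hm1)
    rw [h𝔣0, Ideal.absNorm_top, mul_one] at h
    exact_mod_cast h
  -- the Deuring-twisted dichotomy
  obtain ⟨hcaseA, hcaseB⟩ := hmain E N hNn hE (hdens N hNn (hA N hNn)) m hm1 hdeg 𝔣 χ p L L' hdata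
    (fun j hj ↦ hnt j (hndvd j hj)) (fun j hj ↦ hL j (hndvd j hj)) (fun j hj ↦ hL' j hj) hord h𝔣0 hχ0 hcond hdE
  -- the Deuring coefficient identity and the ramified junk, at `x ≥ Q^{a₁}`
  set wr : Ideal (𝓞 E) → ℝ := fun I ↦ if (∃ v : HeightOneSpectrum (𝓞 E), ¬ Algebra.IsUnramifiedIn (𝓞 N) v.asIdeal ∧
      ∃ k : ℕ, 0 < k ∧ I = v.asIdeal ^ k) then 1 else 0 with hwrdef
  have hwr : ∀ I, wr I = if (∃ v : HeightOneSpectrum (𝓞 E), ¬ Algebra.IsUnramifiedIn (𝓞 N) v.asIdeal ∧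
      ∃ k : ℕ, 0 < k ∧ I = v.asIdeal ^ k) then 1 else 0 := fun I ↦ rfl
  have hray : ∀ j, 𝔣 j ≠ ⊥ ∧ IsRayClassCharacter (𝔣 j) (χ j) := fun j ↦ ⟨(hdata j).1, (hdata j).2.1⟩
  have hjunk : ∀ (τ : N ≃ₐ[E] N) (wτ : Ideal (𝓞 E) → ℝ),
      (∀ I, wτ I = if (∃ v : HeightOneSpectrum (𝓞 E), Algebra.IsUnramifiedIn (𝓞 N) v.asIdeal ∧
        ∃ k : ℕ, I = v.asIdeal ^ k ∧ galFrob E N v ^ k = τ) then 1 else 0) →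
      ∀ x : ℝ, Q ^ a₁ ≤ x →
      ‖∑ j ∈ Finset.range m, (((χ₁ τ : ℂˣ) : ℂ)⁻¹) ^ j * coefFordK (rcCoef (𝔣 j) (χ j)) (tzTest (Real.log x) (x ^ (-ν))) 0 -
          (m : ℂ) * ((∑' k : ℕ, (∑ I ∈ idealsOfNorm E k, wτ I * idealVonMangoldt I) *
            tzTest (Real.log x) (x ^ (-ν)) (Real.log k) : ℝ) : ℂ)‖ ≤
        n₀ * ((NumberField.discr N).natAbs.primeFactors.card) * (Real.log x + 1) := by
    intro τ wτ hwτ x hx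
    have hxQ : Q ≤ x := by
      have : Q ^ (1 : ℝ) ≤ Q ^ a₁ := Real.rpow_le_rpow_of_exponent_le hQ1.le ha₁1
      rw [Real.rpow_one] at this; linarith
    have hx1 : 1 < x := by linarith
    have hx0 : 0 < x := by linarith
    have hL0 : 0 < Real.log x := Real.log_pos hx1
    set ε : ℝ := x ^ (-ν) with hε
    have hε0 : 0 < ε := Real.rpow_pos_of_pos hx0 _
    have hε1 : ε ≤ 1 := Real.rpow_le_one_of_one_le_of_nonpos hx1.le (by linarith)
    have h1 := norm_sum_coefFordK_sub_le hχ₁ hcard hray hsupp hval τ hwτ hwr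
      (g := tzTest (Real.log x) ε) (X := Real.log x + ε) (fun u hu ↦ tzTest_eq_zero_of_ge hL0 hε0 hu)
    -- `|g| = g` and the smoothed junk is at most `ψ_{w_ram}(x e^ε)`
    have habs : ∀ k : ℕ, |tzTest (Real.log x) ε (Real.log k)| = tzTest (Real.log x) ε (Real.log k) :=
      fun k ↦ abs_of_nonneg (tzTest_mem_Icc _ _ _).1
    simp_rw [habs] at h1
    have hw0 : ∀ I, 0 ≤ wr I := fun I ↦ by rw [hwr I]; split_ifs <;> norm_num
    have h2 := smoothedPsiWeighted_le_psiWeighted (K := E) (w := wr) hw0 hx1 hε0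
    have hy : (1 : ℝ) ≤ x * Real.exp ε := by
      have : 1 ≤ Real.exp ε := by linarith [Real.add_one_le_exp ε]
      nlinarith
    have h3 := psiWeighted_ram_le (E := E) (N := N) hwr hy
    have hlogy : Real.log (x * Real.exp ε) = Real.log x + ε := by
      rw [Real.log_mul hx0.ne' (Real.exp_pos ε).ne', Real.log_exp]
    rw [hlogy] at h3
    have hω0 : (0 : ℝ) ≤ ((NumberField.discr N).natAbs.primeFactors.card : ℝ) := Nat.cast_nonneg _
    have hnE0 : (0 : ℝ) ≤ Module.finrank ℚ E := Nat.cast_nonneg _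
    have h4 : (m : ℝ) * (∑' k : ℕ, (∑ I ∈ idealsOfNorm E k, wr I * idealVonMangoldt I) * tzTest (Real.log x) ε (Real.log k)) ≤
        n₀ * ((NumberField.discr N).natAbs.primeFactors.card) * (Real.log x + 1) := by
      have hm0 : (0 : ℝ) ≤ m := Nat.cast_nonneg _
      calc (m : ℝ) * (∑' k : ℕ, (∑ I ∈ idealsOfNorm E k, wr I * idealVonMangoldt I) * tzTest (Real.log x) ε (Real.log k))
          ≤ m * (Module.finrank ℚ E * ((NumberField.discr N).natAbs.primeFactors.card) * (Real.log x + ε)) :=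
            mul_le_mul_of_nonneg_left (h2.trans h3) hm0
        _ = n₀ * ((NumberField.discr N).natAbs.primeFactors.card) * (Real.log x + ε) := by
            rw [← hNn, hdeg]; push_cast; ring
        _ ≤ n₀ * ((NumberField.discr N).natAbs.primeFactors.card) * (Real.log x + 1) := by
            refine mul_le_mul_of_nonneg_left (by linarith) (by positivity)
    exact h1.trans h4
  -- the window comparison `c' ≤ c`, `c' ≤ c₀`
  have hlogd0 : 0 ≤ Real.log ((NumberField.discr N).natAbs : ℝ) := Real.log_natCast_nonneg _
  have hlog4 : 0 < Real.log 4 := Real.log_pos (by norm_num)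
  have hwin_mono : ∀ {c₁ c₂ β₁ : ℝ}, c₁ ≤ c₂ →
      1 - c₁ / (Real.log ((NumberField.discr N).natAbs : ℝ) + Real.log 4) < β₁ →
      1 - c₂ / (Real.log ((NumberField.discr N).natAbs : ℝ) + Real.log 4) < β₁ := by
    intro c₁ c₂ β₁ h12 h
    have := div_le_div_of_nonneg_right h12 (by linarith : 0 ≤ Real.log ((NumberField.discr N).natAbs : ℝ) + Real.log 4)
    linarith
  -- the (B)-type conversion, shared by (B) and (B')
  have hBconv : ∀ (β₁ : ℝ) (j₀ : ℕ),
      (∀ (cc : ℂ), ‖cc‖ ≤ 1 → ∀ x : ℝ, ThornerZaman.condQn N ^ a₁ ≤ x →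
        ‖∑ j ∈ Finset.range m, cc ^ j * coefFordK (rcCoef (𝔣 j) (χ j)) (tzTest (Real.log x) (x ^ (-ν))) 0 -
            fordLaplace (tzTest (Real.log x) (x ^ (-ν))) (-1) +
            cc ^ j₀ * fordLaplace (tzTest (Real.log x) (x ^ (-ν))) (-(β₁ : ℂ))‖ ≤
          η * x * min 1 ((1 - β₁) * Real.log x)) →
      ∀ (τ : N ≃ₐ[E] N) (wτ : Ideal (𝓞 E) → ℝ),
        (∀ I, wτ I = if (∃ v : HeightOneSpectrum (𝓞 E), Algebra.IsUnramifiedIn (𝓞 N) v.asIdeal ∧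
          ∃ k : ℕ, I = v.asIdeal ^ k ∧ galFrob E N v ^ k = τ) then 1 else 0) →
        ∀ x : ℝ, ThornerZaman.condQn N ^ a₁ ≤ x →
          ‖(m : ℂ) * ((∑' k : ℕ, (∑ I ∈ idealsOfNorm E k, wτ I * idealVonMangoldt I) *
                tzTest (Real.log x) (x ^ (-ν)) (Real.log k) : ℝ) : ℂ) -
              fordLaplace (tzTest (Real.log x) (x ^ (-ν))) (-1) +
              (((χ₁ τ : ℂˣ) : ℂ)⁻¹) ^ j₀ * fordLaplace (tzTest (Real.log x) (x ^ (-ν))) (-(β₁ : ℂ))‖ ≤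
            η * x * min 1 ((1 - β₁) * Real.log x) +
              n₀ * ((NumberField.discr N).natAbs.primeFactors.card) * (Real.log x + 1) := by
    intro β₁ j₀ hB τ wτ hwτ x hx
    have hB' := hB (((χ₁ τ : ℂˣ) : ℂ)⁻¹) (norm_inv_character_le_one χ₁ τ) x hx
    have hJ := hjunk τ wτ hwτ x hx
    set T : ℂ := ((m : ℂ) * ((∑' k : ℕ, (∑ I ∈ idealsOfNorm E k, wτ I * idealVonMangoldt I) *
        tzTest (Real.log x) (x ^ (-ν)) (Real.log k) : ℝ) : ℂ)) with hT
    set S : ℂ := ∑ j ∈ Finset.range m, (((χ₁ τ : ℂˣ) : ℂ)⁻¹) ^ j *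
        coefFordK (rcCoef (𝔣 j) (χ j)) (tzTest (Real.log x) (x ^ (-ν))) 0 with hS
    set F1 : ℂ := fordLaplace (tzTest (Real.log x) (x ^ (-ν))) (-1) with hF1
    set Fβ : ℂ := (((χ₁ τ : ℂˣ) : ℂ)⁻¹) ^ j₀ * fordLaplace (tzTest (Real.log x) (x ^ (-ν))) (-(β₁ : ℂ)) with hFβ
    have he : T - F1 + Fβ = (S - F1 + Fβ) + (T - S) := by ring
    rw [he]
    refine (norm_add_le _ _).trans ?_
    rw [norm_sub_rev] at hJ
    linarith
  refine ⟨χ₁, hχ₁, fun τ wτ hwτ x hx hnoexc ↦ ?_, fun β₁ hζ hwin hβ1 ↦ ?_, fun β₁ hζ hwin hβ1 ↦ ?_⟩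
  · -- (A)
    have hA' := hcaseA (((χ₁ τ : ℂˣ) : ℂ)⁻¹) (norm_inv_character_le_one χ₁ τ) x hx hnoexc
    have hJ := hjunk τ wτ hwτ x hx
    -- triangle inequality
    have := norm_sub_le_norm_sub_add_norm_sub
      ((m : ℂ) * ((∑' k : ℕ, (∑ I ∈ idealsOfNorm E k, wτ I * idealVonMangoldt I) *
        tzTest (Real.log x) (x ^ (-ν)) (Real.log k) : ℝ) : ℂ))
      (∑ j ∈ Finset.range m, (((χ₁ τ : ℂˣ) : ℂ)⁻¹) ^ j * coefFordK (rcCoef (𝔣 j) (χ j)) (tzTest (Real.log x) (x ^ (-ν))) 0)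
      (fordLaplace (tzTest (Real.log x) (x ^ (-ν))) (-1))
    rw [norm_sub_rev] at hJ
    linarith
  · -- (B)
    obtain ⟨j₀, hj₀m, -, hB⟩ := hcaseB β₁ hζ hwin hβ1
    exact ⟨j₀, hj₀m, hBconv β₁ j₀ hB⟩
  · -- (B'): the signed version in the `c'`-window
    obtain ⟨j₀, hj₀m, hwhich, hB⟩ := hcaseB β₁ hζ (hwin_mono hc'c hwin) hβ1
    -- `β₁` is a simple zero of `ζ₁_N` (Landau–Page, constant `c₀ ≥ c'`)
    obtain ⟨-, -, hLPsimple⟩ := hpack N hNn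
    have hβim : ((β₁ : ℂ)).im = 0 := Complex.ofReal_im β₁
    have hZ : (((1 : ClassGroup (𝓞 N) →* ℂˣ) = 1 → dedekindZeta₁ N β₁ = 0) ∧
        ((1 : ClassGroup (𝓞 N) →* ℂˣ) ≠ 1 → classGroupLFunction₀ N 1 β₁ = 0)) ∧
        1 - c₀ / (Real.log ((NumberField.discr N).natAbs : ℝ) + Real.log (|((β₁ : ℂ)).im| + 4)) <
          ((β₁ : ℂ)).re := by
      refine ⟨⟨fun _ ↦ hζ, fun h ↦ absurd rfl h⟩, ?_⟩
      rw [hβim, abs_zero, zero_add, Complex.ofReal_re]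
      exact hwin_mono hc'c₀ hwin
    have hsimple' : analyticOrderAt (dedekindZeta₁ N) β₁ = 1 := (hLPsimple 1 β₁ hZ).1 rfl
    have hsimple : analyticOrderNatAt (dedekindZeta₁ N) β₁ = 1 := by
      rw [analyticOrderNatAt, hsimple']; rfl
    have hβ0 : 0 < β₁ := by
      have h1 : c' / (Real.log ((NumberField.discr N).natAbs : ℝ) + Real.log 4) ≤ 1 := by
        rw [div_le_one (by linarith)]
        have hlog4' : 1 < Real.log 4 := by
          rw [show (4:ℝ) = 2 ^ 2 by norm_num, Real.log_pow]; have := Real.log_two_gt_d9; push_cast; linarith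
        have : c' ≤ 1 := hc'c.trans (hcn.trans (by
          rw [div_le_one (by positivity)]; nlinarith))
        linarith
      linarith
    have hLIco : ∀ j ∈ Finset.Ico 1 m, Differentiable ℂ (L j) ∧
        ∀ s : ℂ, 1 < s.re → L j s = rayClassLSeries (𝔣 j) (χ j) s := fun j hj ↦ hL j (hndvd j hj)
    have hntIco : ∀ j ∈ Finset.Ico 1 m, ∃ v : HeightOneSpectrum (𝓞 E), ¬ 𝔣 j ≤ v.asIdeal ∧ χ j v ≠ 1 :=
      fun j hj ↦ hnt j (hndvd j hj)
    refine ⟨j₀, hj₀m, ?_, ?_, hBconv β₁ j₀ hB⟩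
    · rcases hwhich with ⟨hj0, hordE⟩ | ⟨hjpos, hordL⟩
      · exact ⟨fun _ ↦ dedekindZeta₁_eq_zero_of_order_one hordE, fun _ ↦ hj0⟩
      · have hj₀mem : j₀ ∈ Finset.Ico 1 m := Finset.mem_Ico.mpr ⟨hjpos, hj₀m⟩
        have hLz : L j₀ β₁ = 0 := apply_eq_zero_of_analyticOrderNatAt_ne_zero (by rw [hordL]; exact one_ne_zero)
        have hEne := heckeIndex_dedekindZeta₁_ne_zero (N := N) 𝔣 χ L (fun j ↦ ⟨(hdata j).1, (hdata j).2.1⟩)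
          hntIco hLIco hord hsimple hj₀mem hLz
        exact ⟨fun h ↦ absurd h hjpos.ne', fun h ↦ absurd h hEne⟩
    · rcases hwhich with ⟨hj0, -⟩ | ⟨hjpos, hordL⟩
      · intro τ; rw [hj0, pow_zero, one_pow]
      · have hj₀mem : j₀ ∈ Finset.Ico 1 m := Finset.mem_Ico.mpr ⟨hjpos, hj₀m⟩
        have hLz : L j₀ β₁ = 0 := apply_eq_zero_of_analyticOrderNatAt_ne_zero (by rw [hordL]; exact one_ne_zero)
        have h2 := heckeIndex_two_mul_eq hcard χ₁ 𝔣 χ p L hdata hval hntIco hLIco hord hβ0 hsimple hj₀mem hLz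
        exact fun τ ↦ character_pow_sq_eq_one_of_two_mul χ₁ hcard h2 τ

end Summit.QuantumAdvantage.QuantumAdvantage.Theorems.DegreeOnePrimesEscape
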